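/-
Copyright (c) 2026 the pub-hodgecm-mathlib formalisation cell (harness21).  Prover seat hodgecm-mathlib-K2Liu-p10 (g4), Track B «K2-LIT»,
#184♮ = hLiu418 = `stmt-HodgeConjecture-24832`; (σ) endgame organ, SMALL SIDE, S-1 part 2d: the CM Gram bridges feeding ★ `slice_letter`.  KERNEL: theorems only.
-/
import Summits.HodgeConjecture.HodgeConjecture.Theorems.K2LiuDoublingSchrodingerModelDefs   -- ★ β-1 defs (`gramRLoc`, `deltaGramLoc`)
import Literature.NumberTheory.K2Lit.DoubledTensorEmbedding                                 -- ★ `tensorFrame`, `epsV`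
import HarnessLib

/-!
# Crux `HLiu418`, (σ) small side, S-1 part 2d: THE LOCAL GRAM OF `𝔻 ⊗ V′` IS `T₀(𝔻) ⊗ dV′` ALONG `epsV`, AND THE LOCAL GRAM OF `𝔻 ⊗ a′` IS `d′·T₀(𝔻)`

Cell `hodgecm-mathlib`, crux item hLiu418 = `stmt-HodgeConjecture-24832`, route of record `HCCMUnconditional`; squad K2 ∕ K2Liu, prover K2Liu-p10 (g4).
THEOREMS ONLY; lane `--supports stmt-HodgeConjecture-24832 --as helper`.  CM datum currency of ★ β-1 ∕ D-A v1: `(L) (e dV hdV dW hdW) (eW e' dV' hdV') (v)`.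

★ S-1 part 2b `slice_letter` is generic in the Gram data `g : Fin n → F_v` (small), `t : Fin 3 → F_v` (`dV′`), `T_B := reindex eV (diagonal (p ↦ g p.1 · t p.2))` (big),
`diagonal (i ↦ d′ · g i)` (the datum `𝔻 ⊗ a′`).  This file identifies them with ★ β-1's `gramRLoc` of the three CM data:
* §1 `gramRLoc_eq_diagonal`: `T₀(𝔻)_v = diagonal g` with `g x = ι(dV (e⁻¹x).1 · dW (e⁻¹x).2)` (`gram = reindex e (diag ⊗ₖ diag)`);
* §2 **`gramRLoc_tensor_eq`**: `T₀(𝔻 ⊗ V′)_v = reindex (epsV e eW e′) (diagonal (p ↦ g p.1 · ι(dV′ p.2)))` — the `T_B` of `slice_letter` with `eV := epsV e eW e′`;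
* §3 **`gramRLoc_smul_eq`**: for the datum `(e, dV, d′·dW)` (`𝔻 ⊗ a′`, `⟨a′, a′⟩ = d′` real): `T₀_v = diagonal (i ↦ ι(d′) · g i)` — the `JS`-Gram of `slice_letter`.
So `deltaGramLoc` of the big ∕ small datum are LITERALLY `deltaGram e₂ T_B` ∕ `deltaGram e₂ (diagonal (d′·g))` (★ `deltaGramLoc_eq`).

HONEST LABEL: HC_CM is proved only modulo the 7 printed citations (2 remaining named inputs: hLiu418 = stmt-HodgeConjecture-24832, h413 = stmt-HodgeConjecture-24833)
until rung 0 closes; helper, closes no item.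
References: [Kudla1994] §2 (doubled space of `V ⊗ W`); [KudlaRallis1994] §1; [GelbartRogawski1991] §3.1 p. 454.
-/

set_option autoImplicit false
set_option linter.dupNamespace false -- the mandated namespace repeats `HodgeConjecture.HodgeConjecture`

noncomputable section

open scoped Matrix Kronecker
open NumberField IsDedekindDomain Matrix
open Literature.NumberTheory.Automorphic
open Literature.NumberTheory.GelbartRogawski1991 Literature.NumberTheory.GelbartRogawski1991.GRConstruction
open Literature.NumberTheory.GelbartRogawski1991.UnitaryDualPair
open Literature.NumberTheory.K2Lit.SiegelDoubled
open Summit.HodgeConjecture.HodgeConjecture.Cruxes.HLiu418.K2LiuDoublingSchrodingerModelDefs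

namespace Summit.HodgeConjecture.HodgeConjecture.Cruxes.HLiu418.K2LiuKRFrameCMGram

variable (L : Type) [Field L] [NumberField L] [IsCMField L]
variable {N M n : ℕ} (e : Fin N × Fin M ≃ Fin n)
  (dV : Fin N → L) (hdV : ∀ i, IsCMField.complexConj L (dV i) = dV i)
  (dW : Fin M → L) (hdW : ∀ i, IsCMField.complexConj L (dW i) = dW i)
variable {M₂ M' n' : ℕ} (eW : Fin M × Fin M₂ ≃ Fin M') (e' : Fin N × Fin M' ≃ Fin n')
  (dV' : Fin M₂ → L) (hdV' : ∀ k, IsCMField.complexConj L (dV' k) = dV' k)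
  (v : HeightOneSpectrum (𝓞 (Fp L)))

/-! ## §1 The local Gram of a diagonal CM datum is diagonal -/

/-- the real element `⟨d, hd⟩ ∈ L⁺` read in `L⁺_v`. [folklore] -/
theorem algebraMap_mk_mul {a b : L} (ha : IsCMField.complexConj L a = a) (hb : IsCMField.complexConj L b = b)
    (hab : IsCMField.complexConj L (a * b) = a * b) :
    algebraMap (Fp L) (v.adicCompletion (Fp L)) ⟨a * b, (IsCMField.complexConj_eq_self_iff (K := L) (a * b)).1 hab⟩ =
      algebraMap (Fp L) (v.adicCompletion (Fp L)) ⟨a, (IsCMField.complexConj_eq_self_iff (K := L) a).1 ha⟩ *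
        algebraMap (Fp L) (v.adicCompletion (Fp L)) ⟨b, (IsCMField.complexConj_eq_self_iff (K := L) b).1 hb⟩ := by
  rw [← map_mul]
  rfl

/-- **`T₀(𝔻)_v = reindex e (diagonal (p ↦ ι(dV p.1) · ι(dW p.2)))`** (`gram = reindex e (diag dV ⊗ₖ diag dW)`). [cite: GelbartRogawski1991, §3.1 p. 454] -/
theorem gramRLoc_eq_reindex_diagonal :
    gramRLoc L e dV hdV dW hdW v =
      Matrix.reindex e e (Matrix.diagonal fun p : Fin N × Fin M =>
        algebraMap (Fp L) (v.adicCompletion (Fp L)) ⟨dV p.1, (IsCMField.complexConj_eq_self_iff (K := L) (dV p.1)).1 (hdV p.1)⟩ *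
          algebraMap (Fp L) (v.adicCompletion (Fp L)) ⟨dW p.2, (IsCMField.complexConj_eq_self_iff (K := L) (dW p.2)).1 (hdW p.2)⟩) := by
  unfold gramRLoc gramR UnitaryDualPair.gram realDiagonal
  rw [Matrix.diagonal_kronecker_diagonal, Matrix.reindex_apply, Matrix.reindex_apply, ← Matrix.submatrix_map, Matrix.diagonal_map (map_zero _)]
  congr 1
  ext p q
  simp only [Matrix.diagonal_apply, map_mul]

/-- the diagonal FUNCTION of `T₀(𝔻)_v`: `g x := T₀(𝔻)_v x x = ι(dV (e⁻¹x).1) · ι(dW (e⁻¹x).2)`. [cite: GelbartRogawski1991, §3.1 p. 454] -/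
theorem gramRLoc_apply_diag (x : Fin n) :
    gramRLoc L e dV hdV dW hdW v x x =
      algebraMap (Fp L) (v.adicCompletion (Fp L)) ⟨dV (e.symm x).1, (IsCMField.complexConj_eq_self_iff (K := L) _).1 (hdV _)⟩ *
        algebraMap (Fp L) (v.adicCompletion (Fp L)) ⟨dW (e.symm x).2, (IsCMField.complexConj_eq_self_iff (K := L) _).1 (hdW _)⟩ := by
  rw [gramRLoc_eq_reindex_diagonal, Matrix.reindex_apply, Matrix.submatrix_diagonal_equiv, Matrix.diagonal_apply_eq]
  rfl

/-- **`T₀(𝔻)_v = diagonal g`**, `g x = T₀(𝔻)_v x x`. [cite: GelbartRogawski1991, §3.1 p. 454] -/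
theorem gramRLoc_eq_diagonal : gramRLoc L e dV hdV dW hdW v = Matrix.diagonal fun x => gramRLoc L e dV hdV dW hdW v x x := by
  conv_lhs => rw [gramRLoc_eq_reindex_diagonal, Matrix.reindex_apply, Matrix.submatrix_diagonal_equiv]
  refine congrArg Matrix.diagonal (funext fun x => ?_)
  rw [gramRLoc_apply_diag]
  rfl

/-! ## §2 The big datum `𝔻 ⊗ V′` along `epsV` -/

/-- **THE BIG GRAM ALONG `epsV`**: `T₀(𝔻 ⊗ V′)_v = reindex (epsV e eW e′) (diagonal (p ↦ g p.1 · ι(dV′ p.2)))` with `g` the diagonal function of `T₀(𝔻)_v` —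
the `T_B` of ★ `slice_letter` at `eV := epsV e eW e′`. [cite: Kudla1994, §2 (doubled space)] [cite: KudlaRallis1994, §1] -/
theorem gramRLoc_tensor_eq :
    gramRLoc L e' dV hdV (tensorFrame L dW eW dV') (tensorFrame_real L dW hdW eW dV' hdV') v =
      Matrix.reindex (epsV e eW e') (epsV e eW e') (Matrix.diagonal fun p : Fin n × Fin M₂ =>
        gramRLoc L e dV hdV dW hdW v p.1 p.1 *
          algebraMap (Fp L) (v.adicCompletion (Fp L)) ⟨dV' p.2, (IsCMField.complexConj_eq_self_iff (K := L) (dV' p.2)).1 (hdV' p.2)⟩) := by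
  rw [gramRLoc_eq_reindex_diagonal, Matrix.reindex_apply, Matrix.reindex_apply, Matrix.submatrix_diagonal_equiv, Matrix.submatrix_diagonal_equiv]
  refine congrArg Matrix.diagonal (funext fun j => ?_)
  simp only [Function.comp_apply]
  -- write `j = epsV (e (i₁, i₂), k)`
  obtain ⟨⟨x, k⟩, rfl⟩ := (epsV e eW e').surjective j
  obtain ⟨⟨i₁, i₂⟩, rfl⟩ := e.surjective x
  rw [Equiv.symm_apply_apply, epsV_apply, Equiv.symm_apply_apply, gramRLoc_apply_diag, Equiv.symm_apply_apply]
  simp only [tensorFrame, Equiv.symm_apply_apply]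
  rw [algebraMap_mk_mul L v (hdW i₂) (hdV' k) (by rw [map_mul, hdW, hdV'])]
  ring

/-! ## §3 The small datum `𝔻 ⊗ a′` (scale `dW` by the real `d′`) -/

include hdW in
/-- the scaled frame `d′·dW` is real. [folklore] -/
theorem smul_real {d' : L} (hd' : IsCMField.complexConj L d' = d') (i : Fin M) : IsCMField.complexConj L (d' * dW i) = d' * dW i := by
  rw [map_mul, hd', hdW]

/-- **THE SMALL GRAM**: for the datum `(e, dV, d′·dW)` (= `𝔻 ⊗ a′`, `⟨a′,a′⟩ = d′`), `T₀_v = diagonal (x ↦ ι(d′) · g x)` — the `JS`-Gram of ★ `slice_letter`.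
[cite: KudlaRallis1994, §1] -/
theorem gramRLoc_smul_eq {d' : L} (hd' : IsCMField.complexConj L d' = d') :
    gramRLoc L e dV hdV (fun i => d' * dW i) (smul_real L dW hdW hd') v =
      Matrix.diagonal fun x => algebraMap (Fp L) (v.adicCompletion (Fp L)) ⟨d', (IsCMField.complexConj_eq_self_iff (K := L) d').1 hd'⟩ *
        gramRLoc L e dV hdV dW hdW v x x := by
  rw [gramRLoc_eq_diagonal]
  refine congrArg Matrix.diagonal (funext fun x => ?_)
  rw [gramRLoc_apply_diag, gramRLoc_apply_diag, algebraMap_mk_mul L v hd' (hdW _) (by rw [map_mul, hd', hdW])]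
  ring

end Summit.HodgeConjecture.HodgeConjecture.Cruxes.HLiu418.K2LiuKRFrameCMGram

end
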